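import Summits.ResolutionOfSingularities.ResolutionOfSingularities.Theorems.UniversalCellsCampaignW82PerfectionDescent
import Summits.ResolutionOfSingularities.ResolutionOfSingularities.Theorems.UniversalCellsCampaignW82PerfectionDescentMvAlgebra
import HarnessLib

/-!
# [OURS · L1 W8.2] THE INVERSE PERFECTION STEP IN MANY VARIABLES: resolution over `(M(x_σ))^{perf}` implies
# resolution over `M`, for every infinite perfect `M` of characteristic `p` and EVERY index set `σ`

Cell `res-hironaka` (run/shared/lean/pub/res-hironaka/), LADDER-RESOLUTION rung L (RESCUE), slot W8.2; host route
`UniversalCells`, host item `PrimeFieldToPerfect` (stmt-ResolutionOfSingularities-15233), door 1. Proofs file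
(Theses-free), written by res-L1-s82-pv-1 (gen 4): the many-variables form of `…PerfectionDescent.lean` (`σ = 1`).
For FINITE `σ` it follows from the one-variable step by the monotone tower; the point is INFINITE `σ` — descent
from the ONE field `(𝔽_p(x₀, x₁, …))^{perf}` to the finite levels (sibling `…OneField.lean`).

* §1 `irreducibleSpace_pullback_specMap_fractionRingMvPolynomial` — `X ×_M Frac(M[x_σ])` is irreducible for
  `X` irreducible (Liu 4.3.8; generic fibre `Spec (κ(ξ) ⊗_M Frac(M[x_σ]))`, a domain by
  `isDomain_tensor_fractionRingMvPolynomial`); `isIntegral_pullback_specMap_of_isPurelyInseparable_mv` —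
  `X ×_M L` is integral for `L ⊇ Frac(M[x_σ])` purely inseparable, `M` perfect;
* §2 **`integralResUpToDim_of_isPurelyInseparable_mv`** — for `M` infinite perfect of characteristic `p` and `L`
  perfect purely inseparable over `Frac(M[x_σ])`: `Res_{≤ n}(L) ⇒ Res_{≤ n}(M)` (every `n`, every `σ`), by the
  general specialization theorem `integralResUpToDim_of_extension_of_rationalPoints` with rational points from
  `exists_rationalPoint_of_algHom_of_isPurelyInseparable_mv`; `integralRes_of_isPurelyInseparable_mv` (all
  dimensions), `integralResolutionOverUpToDim_of_isPurelyInseparable_mv` (ℕ-graded, tree name).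

HONEST FRAMING. OURS theorems about OURS statements (role replaced: §17 ¶2 p.89 l.59–62 of [Hironaka2017], typed AS
PRINTED as `S17Methodology.U89_3`); NOT statements of the manuscript; nothing attributed to its author; no typed
candidate used. No resolution is base-changed along an inseparable extension. AI work, weaker than expert review;
no claim beyond the kernel.

Sources: EGA IV₃ 8.10.5; Q. Liu, *Algebraic Geometry and Arithmetic Curves* (2002), Prop. 4.3.8.
[cite: EGAIV3, Thm. 8.10.5] [cite: Liu2002, Prop. 4.3.8]
-/

noncomputable section

set_option linter.dupNamespace false -- mandated namespace of this single-conjunct summit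

open CategoryTheory CategoryTheory.Limits AlgebraicGeometry TopologicalSpace
open Literature.AlgebraicGeometry.Resolution
open scoped TensorProduct

namespace Summit.ResolutionOfSingularities.ResolutionOfSingularities.Theorems.CampaignW82

/-! ## §1 `X ×_M L` is integral for `L ⊇ Frac(M[x_σ])` purely inseparable, `M` perfect -/

/-- **`X ×_M Frac(M[x_σ])` is irreducible** for `X` irreducible over a field `M` (flat projection with irreducible
generic fibre `Spec (κ(ξ) ⊗_M Frac(M[x_σ]))`; Liu 4.3.8). [cite: Liu2002, Prop. 4.3.8] -/
theorem irreducibleSpace_pullback_specMap_fractionRingMvPolynomial {M : Type} [Field M] (σ : Type)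
    {X : Scheme.{0}} (f : X ⟶ Spec (.of M)) [IrreducibleSpace X] :
    IrreducibleSpace
      ↥(pullback f (Spec.map (CommRingCat.ofHom (algebraMap M (FractionRing (MvPolynomial σ M)))))) := by
  set K := FractionRing (MvPolynomial σ M) with hK
  set iK := Spec.map (CommRingCat.ofHom (algebraMap M K)) with hiK
  let q := pullback.fst f iK
  haveI : Flat iK := DeJong1996.Stage.flat_specMap _
  haveI : Flat q := MorphismProperty.pullback_fst _ _ inferInstance
  set ξ := genericPoint X with hξ
  let g := X.fromSpecResidueField ξ
  obtain ⟨φ, hφ⟩ := Spec.map_surjective (g ≫ f)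
  letI : Algebra M (X.residueField ξ) := φ.hom.toAlgebra
  have hφ' : Spec.map (CommRingCat.ofHom (algebraMap M (X.residueField ξ))) = g ≫ f := by
    rw [RingHom.algebraMap_toAlgebra, CommRingCat.ofHom_hom]; exact hφ
  haveI : IsDomain (X.residueField ξ ⊗[M] K) := isDomain_tensor_fractionRingMvPolynomial M (X.residueField ξ) σ
  haveI : IrreducibleSpace ↥(Spec (CommRingCat.of (X.residueField ξ ⊗[M] K))) :=
    inferInstanceAs (IrreducibleSpace (PrimeSpectrum (X.residueField ξ ⊗[M] K)))
  let e : Spec (CommRingCat.of (X.residueField ξ ⊗[M] K)) ⟶ q.fiber ξ :=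
    (pullbackSpecIso M (X.residueField ξ) K).inv ≫
      (pullback.congrHom hφ' rfl).hom ≫ (pullbackRightPullbackFstIso f iK g).inv ≫ (pullbackSymmetry q g).inv
  haveI : IsIso e := by dsimp only [e]; infer_instance
  haveI : IrreducibleSpace ↥(q.fiber ξ) := Function.Surjective.irreducibleSpace e.continuous e.surjective
  exact irreducibleSpace_of_flat_of_irreducibleSpace_fiber q

/-- **`X ×_M L` is integral** for `X` integral and locally of finite type over a PERFECT field `M` and a field
`L ⊇ Frac(M[x_σ])` purely inseparable over it (composite `M`-structure). [folklore] -/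
theorem isIntegral_pullback_specMap_of_isPurelyInseparable_mv {M : Type} [Field M] [PerfectField M] (σ : Type)
    {L : Type} [Field L] [Algebra (FractionRing (MvPolynomial σ M)) L]
    [IsPurelyInseparable (FractionRing (MvPolynomial σ M)) L] [Algebra M L]
    [IsScalarTower M (FractionRing (MvPolynomial σ M)) L] {X : Scheme.{0}} (f : X ⟶ Spec (.of M))
    [LocallyOfFiniteType f] [IsIntegral X] :
    IsIntegral (pullback f (Spec.map (CommRingCat.ofHom (algebraMap M L)))) := by
  set K := FractionRing (MvPolynomial σ M) with hK
  let iK := Spec.map (CommRingCat.ofHom (algebraMap M K))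
  let iKL := Spec.map (CommRingCat.ofHom (algebraMap K L))
  let iL := Spec.map (CommRingCat.ofHom (algebraMap M L))
  have hcomp : iKL ≫ iK = iL := by
    change Spec.map _ ≫ Spec.map _ = Spec.map _
    rw [← Spec.map_comp, ← CommRingCat.ofHom_comp, ← IsScalarTower.algebraMap_eq M K L]
  haveI : IrreducibleSpace ↥(pullback f iK) := irreducibleSpace_pullback_specMap_fractionRingMvPolynomial σ f
  haveI : IrreducibleSpace ↥(pullback (pullback.snd f iK) iKL) :=
    irreducibleSpace_pullback_of_isPurelyInseparable (K := K) (L := L) (pullback.snd f iK)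
  let e : pullback (pullback.snd f iK) iKL ⟶ pullback f iL :=
    (pullbackLeftPullbackSndIso f iK iKL).hom ≫ (pullback.congrHom rfl hcomp).hom
  haveI : IsIso e := by dsimp only [e]; infer_instance
  haveI : IrreducibleSpace ↥(pullback f iL) := Function.Surjective.irreducibleSpace e.continuous e.surjective
  haveI : IsReduced (pullback f iL) := isReduced_pullback_specMap_of_perfectField (algebraMap M L) f
  exact isIntegral_of_irreducibleSpace_of_isReduced _

/-! ## §2 The inverse perfection step in many variables -/

/-- **THE INVERSE PERFECTION STEP IN MANY VARIABLES (graded).** Let `M` be an INFINITE perfect field of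
characteristic `p`, `σ` any index type, and `L` a perfect field purely inseparable over `Frac(M[x_σ])` (e.g.
`(M(x_σ))^{perf}`), with the composite `M`-structure. If every integral separated scheme of finite type over `L` of
dimension `≤ n` has a resolution, then so does every one over `M`. [cite: EGAIV3, Thm. 8.10.5] -/
theorem integralResUpToDim_of_isPurelyInseparable_mv (p : ℕ) [Fact p.Prime] (M : Type) [Field M] [CharP M p]
    [PerfectField M] [Infinite M] (σ : Type) (L : Type) [Field L] [Algebra (FractionRing (MvPolynomial σ M)) L]
    [IsPurelyInseparable (FractionRing (MvPolynomial σ M)) L] [PerfectField L] [Algebra M L]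
    [IsScalarTower M (FractionRing (MvPolynomial σ M)) L] (n : WithBot ℕ∞)
    (hL : ∀ (X : Scheme.{0}) (f : X ⟶ Spec (.of L)), IsSeparated f → LocallyOfFiniteType f →
      QuasiCompact f → IsIntegral X → topologicalKrullDim X ≤ n → Scheme.HasResolution X)
    (X : Scheme.{0}) (f : X ⟶ Spec (.of M)) (hs : IsSeparated f) (hl : LocallyOfFiniteType f)
    (hq : QuasiCompact f) (hX : IsIntegral X) (hdim : topologicalKrullDim X ≤ n) :
    Scheme.HasResolution X :=
  integralResUpToDim_of_extension_of_rationalPoints M L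
    (fun R _ _ hft ψ hψ O hO hne => by
      haveI := hft
      exact exists_rationalPoint_of_algHom_of_isPurelyInseparable_mv p (σ := σ) ψ hψ hO hne)
    (fun Y g hg hY => by
      haveI := hg
      haveI := hY
      exact isIntegral_pullback_specMap_of_isPurelyInseparable_mv σ g)
    n hL X f hs hl hq hX hdim

/-- **All dimensions**: resolution over `L ⊇ Frac(M[x_σ])` perfect purely inseparable implies resolution over the
infinite perfect `M`. [cite: EGAIV3, Thm. 8.10.5] -/
theorem integralRes_of_isPurelyInseparable_mv (p : ℕ) [Fact p.Prime] (M : Type) [Field M] [CharP M p]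
    [PerfectField M] [Infinite M] (σ : Type) (L : Type) [Field L] [Algebra (FractionRing (MvPolynomial σ M)) L]
    [IsPurelyInseparable (FractionRing (MvPolynomial σ M)) L] [PerfectField L] [Algebra M L]
    [IsScalarTower M (FractionRing (MvPolynomial σ M)) L]
    (hL : ∀ (X : Scheme.{0}) (f : X ⟶ Spec (.of L)), IsSeparated f → LocallyOfFiniteType f →
      QuasiCompact f → IsIntegral X → Scheme.HasResolution X)
    (X : Scheme.{0}) (f : X ⟶ Spec (.of M)) (hs : IsSeparated f) (hl : LocallyOfFiniteType f)
    (hq : QuasiCompact f) (hX : IsIntegral X) : Scheme.HasResolution X :=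
  integralResUpToDim_of_isPurelyInseparable_mv p M σ L ⊤
    (fun Y g hs' hl' hq' hY _ => hL Y g hs' hl' hq' hY) X f hs hl hq hX le_top

/-- **The ℕ-graded form** by the tree's name `IntegralResolutionOverUpToDim`. [cite: EGAIV3, Thm. 8.10.5] -/
theorem integralResolutionOverUpToDim_of_isPurelyInseparable_mv (p : ℕ) [Fact p.Prime] (M : Type) [Field M]
    [CharP M p] [PerfectField M] [Infinite M] (σ : Type) (L : Type) [Field L]
    [Algebra (FractionRing (MvPolynomial σ M)) L] [IsPurelyInseparable (FractionRing (MvPolynomial σ M)) L]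
    [PerfectField L] [Algebra M L] [IsScalarTower M (FractionRing (MvPolynomial σ M)) L] (d : ℕ)
    (hL : IntegralResolutionOverUpToDim.{0} L d) : IntegralResolutionOverUpToDim.{0} M d :=
  fun X f hs hl hq hX hdim =>
    integralResUpToDim_of_isPurelyInseparable_mv p M σ L (d : WithBot ℕ∞)
      (fun Y g hs' hl' hq' hY hYd => hL Y g hs' hl' hq' hY (by exact_mod_cast hYd)) X f hs hl hq hX
      (by exact_mod_cast hdim)

end Summit.ResolutionOfSingularities.ResolutionOfSingularities.Theorems.CampaignW82

end
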